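import Summits.ValiantsHypothesis.ValiantsHypothesis.Theorems.EquivariantDialParityCut
import Summits.ValiantsHypothesis.ValiantsHypothesis.Theorems.EquivariantDialFiniteLifts
import HarnessLib

/-!
# The signed-row notch of the equivariant dial, decided by parity characters at a Nisan cut

Support file of the decomposition workshop (lens 1, g31, OFFER O-L1-24, S2; helper of `CollapseToVPws`,
route DefinabilityGap).  KNOWN-TYPE (LR-class restricted-model lower bound; exponent m/2, not m) ·
NEW-COMBINATION (LR17 Thm 2.8's torus-weight count ↦ parity characters of the 2-torsion (ℤ/2)^m, applied to
the lineage's Nisan-cut ideal) · kernel-new · 0 S-currency · closes NO item · NOT a route · residual of the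
decided notch ≡ W (LESSON 6) · P-ROW STAYS UNDECIDED (the residual step is exactly removing the m sign flips) ·
DcPerSuperpolynomial / MS / VP ≠ VNP untouched.

MODEL.  The notch `B_m`-rows (`signedRowSubst m ≤ GL(m²)`): the substitutions `x_{(i,j)} ↦ ε_i x_{(σ i, j)}`
(`σ ∈ 𝔖_m`, `ε ∈ {±1}^m`) of the `m²` variables — the hyperoctahedral group `(ℤ/2)^m ⋊ 𝔖_m` of the ROWS,
acting on one side only; FINITE (`finite_signedRowSubst`), torus-free, `⊉ Δ𝔖_m`; it contains the ROW
permutations `𝔖_m × 1` of the window (`mem_of_eq_permMatrix_prodCongr_refl`) and sits inside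
Landsberg–Ressayre's left monomial symmetries `N(T^E) × 1` (`signedRowSubst_le_leftMonomialSubst`).  An
equivariant representation is the tree's `IsEquivariantDetRepr` (affine `s × s` matrix of degree-`≤ 1` entries,
`det = per_m`, every `γ ∈ B_m` lifted EXACTLY by some `(g, h) ∈ GL_s × GL_s`, LR17 Def 1.3).  NON-VACUITY:
B_m-row-equivariant (exact lifts) affine determinantal representations of per_m EXIST for every m — Grenet's
size-(2^m − 1) representation respects N(T^{GL(E)}) ⊇ B_m [LandsbergRessayre2017 Prop 2.9; Grenet 2011], so
the bound C(m,⌊m/2⌋)^{1/2} ≤ s ≤ 2^m − 1 brackets edc_{B_m-rows}(per_m); not formalised (this file proves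
only the lower bound).

RESULTS.  ★ `choose_le_sq_of_isEquivariantDetRepr`: for `m ≥ 3`, a `B_m`-row-equivariant affine
determinantal representation of `per_m` of size `s` has `C(m, d) ≤ s²` for every `d ≤ m`.  ★ `eqHard_signedRow`:
`EqHard B`-rows — no polynomial-size family (the central binomial coefficient beats every `(m^c + c)²`,
`exists_sq_lt_centralBinom`); `eqHard_of_signedRow_le`: every notch `H ⊇ B_m`-rows is decided, a torus-free
second proof of the LR cell `eqHard_leftMonomial`; `eqHardLayered_signedRow`: the layered cell at the notch;
`symCheap_signedRow_iff`: the residual piece of the notch toward `W = DcPerSuperpolynomial ℂ` is `W` itself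
(LESSON 6) — so nothing here is S-currency, and the P-ROW notch `𝔖_m × 1` (no sign flips) STAYS UNDECIDED.

PROOF.  Finite notch ⇒ finite lifts (`exists_finLift_of_isEquivariantDetRepr`) ⇒ block gauge of inner size
`s' - 1 ≤ s - 1` (`hasBlockGaugeRepr_of_finLifts`, `m ≥ 3`) ⇒ a `B_m`-equivariant homogeneous layered program
of width `≤ (s-1)² + s ≤ s²` (`hasLayeredWidthLE_of_hasBlockGaugeRepr`) ⇒ at the Nisan cut `d` a `B_m`-stable set
of `≤ s²` degree-`d` forms generating an ideal that contains `per_m` (`HasLayeredWidthLE.hasIdealWidthLE`) ⇒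
PARITY (`EquivariantDialParityCut.choose_le_card_of_stable`: the isotypic projectors of the `m` row sign-flip
characters and the transitivity of the row permutations on `d`-subsets yield `C(m, d)` independent vectors).
The torus of LR17 Thm 2.8 is replaced by its 2-torsion; the count `2^m - 1` by the single summand `C(m, d)`.

Related tree objects NOT imported (different models: permutation representations of signed permutations, not
substitution matrices of the `m²` variables): `Literature.LinearAlgebra.Matrix.signedPermGroup`,
`Literature.GroupTheory.Coxeter.signedPermGroup`.

References: J. M. Landsberg, N. Ressayre, *Permanent v. determinant: an exponential lower bound assuming
symmetry and a potential path towards Valiant's conjecture*, Differential Geom. Appl. 55 (2017), Def 1.3,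
Thm 2.8, Prop 2.9, §2.1 [cite: LandsbergRessayre2017, Thm 2.8]; B. Grenet, *An upper bound for the permanent
versus determinant problem* (2011) [cite: LandsbergRessayre2017, Prop 2.9].
-/

set_option linter.dupNamespace false

noncomputable section

namespace Summit.ValiantsHypothesis.ValiantsHypothesis.Theorems.EquivariantDialSignedRows

open MvPolynomial Matrix Literature.Computability.AlgebraicComplexity
open scoped Kronecker
open Summit.ValiantsHypothesis.ValiantsHypothesis.Theorems.EquivariantDialNode
open Summit.ValiantsHypothesis.ValiantsHypothesis.Theorems.EquivariantDialLayers
open Summit.ValiantsHypothesis.ValiantsHypothesis.Theorems.EquivariantDialNotchTransfer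
open Summit.ValiantsHypothesis.ValiantsHypothesis.Theorems.EquivariantDialFiniteLifts
open Summit.ValiantsHypothesis.ValiantsHypothesis.Theorems.EquivariantDialParityCut

/-! ## The signed row permutations as substitution matrices -/

/-- The substitution matrix of `x_{(i,j)} ↦ ε_i • x_{(σ i, j)}` (a signed row permutation of the `m × m`
variable matrix; tree convention `linSubst A (X w) = ∑ v, A v w • X v`). [cite: LandsbergRessayre2017, §2.1] -/
def signedRowMatrix (m : ℕ) (σ : Equiv.Perm (Fin m)) (ε : Fin m → ℤˣ) :
    Matrix (Fin m × Fin m) (Fin m × Fin m) ℂ :=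
  Matrix.of fun v w => if v.1 = σ w.1 ∧ v.2 = w.2 then (((ε w.1 : ℤˣ) : ℤ) : ℂ) else 0

variable {m : ℕ}

/-- Unit and product of signed row permutations. [folklore] -/
theorem signedRowMatrix_one : signedRowMatrix m 1 1 = 1 := by
  ext v w
  unfold signedRowMatrix
  rw [Matrix.of_apply, Matrix.one_apply, Equiv.Perm.one_apply, Pi.one_apply, Units.val_one, Int.cast_one]
  exact if_congr Prod.ext_iff.symm rfl rfl

/-- Composition law `(σ, ε) · (τ, δ) = (σ τ, (ε ∘ τ) δ)`. [folklore] -/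
theorem signedRowMatrix_mul (σ τ : Equiv.Perm (Fin m)) (ε δ : Fin m → ℤˣ) :
    signedRowMatrix m σ ε * signedRowMatrix m τ δ = signedRowMatrix m (σ * τ) (fun i => ε (τ i) * δ i) := by
  ext v w
  unfold signedRowMatrix
  rw [Matrix.mul_apply, Matrix.of_apply, Finset.sum_eq_single (τ w.1, w.2)]
  · rw [Matrix.of_apply, Matrix.of_apply, if_pos (And.intro rfl rfl), Equiv.Perm.mul_apply, Units.val_mul,
      Int.cast_mul]
    by_cases h : v.1 = σ (τ w.1) ∧ v.2 = w.2
    · rw [if_pos h, if_pos h]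
    · rw [if_neg h, if_neg h, zero_mul]
  · intro u _ hu
    rw [Matrix.of_apply, Matrix.of_apply,
      if_neg (show ¬(u.1 = τ w.1 ∧ u.2 = w.2) from fun h => hu (Prod.ext h.1 h.2)), mul_zero]
  · exact fun h => absurd (Finset.mem_univ _) h

/-- The inverse signed row permutation `(σ⁻¹, (ε ∘ σ⁻¹)⁻¹)`. [folklore] -/
theorem signedRowMatrix_mul_inv (σ : Equiv.Perm (Fin m)) (ε : Fin m → ℤˣ) :
    signedRowMatrix m σ ε * signedRowMatrix m σ⁻¹ (fun i => (ε (σ⁻¹ i))⁻¹) = 1 := by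
  have h : (fun i => ε (σ⁻¹ i) * (ε (σ⁻¹ i))⁻¹) = (1 : Fin m → ℤˣ) := funext fun i => mul_inv_cancel _
  rw [signedRowMatrix_mul, mul_inv_cancel, h, signedRowMatrix_one]

/-- THE SIGNED-ROW NOTCH `B_m`-rows: the substitutions `x_{(i,j)} ↦ ε_i x_{(σ i, j)}` (`σ ∈ 𝔖_m`, `ε_i = ±1`)
of the `m²` variables, as a subgroup of `GL(m²)` — the hyperoctahedral group of the ROWS; one-sided, finite,
`⊉ Δ𝔖_m`, between ROW `𝔖_m × 1` and Landsberg–Ressayre's left torus-normaliser `N(T^E) × 1`.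
[cite: LandsbergRessayre2017, §2.1] -/
def signedRowSubst (m : ℕ) : Subgroup (GL (Fin m × Fin m) ℂ) where
  carrier := {γ | ∃ (σ : Equiv.Perm (Fin m)) (ε : Fin m → ℤˣ),
    (γ : Matrix (Fin m × Fin m) (Fin m × Fin m) ℂ) = signedRowMatrix m σ ε}
  mul_mem' := by
    rintro γ γ' ⟨σ, ε, h⟩ ⟨τ, δ, h'⟩
    exact ⟨σ * τ, fun i => ε (τ i) * δ i, by rw [Units.val_mul, h, h', signedRowMatrix_mul]⟩
  one_mem' := by
    exact ⟨1, 1, by rw [Units.val_one, signedRowMatrix_one]⟩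
  inv_mem' := by
    rintro γ ⟨σ, ε, h⟩
    exact ⟨σ⁻¹, fun i => (ε (σ⁻¹ i))⁻¹,
      Units.inv_eq_of_mul_eq_one_right (by rw [h]; exact signedRowMatrix_mul_inv σ ε)⟩

/-- Membership unfolded. [folklore] -/
theorem mem_signedRowSubst_iff {γ : GL (Fin m × Fin m) ℂ} :
    γ ∈ signedRowSubst m ↔ ∃ (σ : Equiv.Perm (Fin m)) (ε : Fin m → ℤˣ),
      (γ : Matrix (Fin m × Fin m) (Fin m × Fin m) ℂ) = signedRowMatrix m σ ε :=
  Iff.rfl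

/-- Every signed row permutation is realised by an element of the notch. [folklore] -/
theorem exists_mem_signedRowMatrix (σ : Equiv.Perm (Fin m)) (ε : Fin m → ℤˣ) :
    ∃ γ ∈ signedRowSubst m, (γ : Matrix (Fin m × Fin m) (Fin m × Fin m) ℂ) = signedRowMatrix m σ ε :=
  ⟨⟨signedRowMatrix m σ ε, signedRowMatrix m σ⁻¹ fun i => (ε (σ⁻¹ i))⁻¹, signedRowMatrix_mul_inv σ ε,
      _root_.mul_eq_one_comm.1 (signedRowMatrix_mul_inv σ ε)⟩,
    mem_signedRowSubst_iff.2 ⟨σ, ε, rfl⟩, rfl⟩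

/-- The notch is FINITE (`|B_m| = 2^m m!` parameters). [folklore] -/
theorem finite_signedRowSubst (m : ℕ) : Finite (signedRowSubst m) := by
  refine Finite.of_surjective (fun p : Equiv.Perm (Fin m) × (Fin m → ℤˣ) =>
    (⟨⟨signedRowMatrix m p.1 p.2, signedRowMatrix m p.1⁻¹ fun i => (p.2 (p.1⁻¹ i))⁻¹,
        signedRowMatrix_mul_inv p.1 p.2, _root_.mul_eq_one_comm.1 (signedRowMatrix_mul_inv p.1 p.2)⟩,
      mem_signedRowSubst_iff.2 ⟨p.1, p.2, rfl⟩⟩ : signedRowSubst m)) ?_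
  rintro ⟨γ, hγ⟩
  obtain ⟨σ, ε, h⟩ := mem_signedRowSubst_iff.1 hγ
  exact ⟨(σ, ε), Subtype.ext (Units.ext h.symm)⟩

/-- The substitution on variables. [folklore] -/
theorem linSubst_signedRowMatrix_X (σ : Equiv.Perm (Fin m)) (ε : Fin m → ℤˣ) (w : Fin m × Fin m) :
    linSubst (Fin m × Fin m) ℂ (signedRowMatrix m σ ε) (X w) = (((ε w.1 : ℤˣ) : ℤ) : ℂ) • X (σ w.1, w.2) := by
  rw [linSubst_X, Finset.sum_eq_single (σ w.1, w.2)]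
  · unfold signedRowMatrix
    rw [Matrix.of_apply, if_pos (And.intro rfl rfl)]
  · intro v _ hv
    unfold signedRowMatrix
    rw [Matrix.of_apply, if_neg (show ¬(v.1 = σ w.1 ∧ v.2 = w.2) from fun h => hv (Prod.ext h.1 h.2)),
      zero_smul]
  · exact fun h => absurd (Finset.mem_univ _) h

/-- Unsigned row permutations act by renaming. [folklore] -/
theorem linSubst_signedRowMatrix_one (σ : Equiv.Perm (Fin m)) (f : MvPolynomial (Fin m × Fin m) ℂ) :
    linSubst (Fin m × Fin m) ℂ (signedRowMatrix m σ 1) f = rename (fun v : Fin m × Fin m => (σ v.1, v.2)) f := by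
  have h : linSubst (Fin m × Fin m) ℂ (signedRowMatrix m σ 1) =
      rename (fun v : Fin m × Fin m => (σ v.1, v.2)) :=
    MvPolynomial.algHom_ext fun w => by
      rw [linSubst_signedRowMatrix_X, rename_X, Pi.one_apply, Units.val_one, Int.cast_one, one_smul]
  rw [h]

/-- The flip of row `i` is the signed row permutation `(1, (1,…,-1,…,1))`. [folklore] -/
theorem signedRowMatrix_flip (i : Fin m) :
    signedRowMatrix m 1 (Function.update 1 i (-1)) = rowFlip m i := by
  ext v w
  unfold signedRowMatrix rowFlip
  rw [Matrix.of_apply, Matrix.diagonal_apply, Equiv.Perm.one_apply, Function.update_apply, Pi.one_apply]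
  by_cases h : v = w
  · rw [h, if_pos (And.intro rfl rfl), if_pos rfl]
    by_cases hi : w.1 = i
    · rw [if_pos hi, if_pos hi, Units.val_neg, Units.val_one, Int.cast_neg, Int.cast_one]
    · rw [if_neg hi, if_neg hi, Units.val_one, Int.cast_one]
  · rw [if_neg (show ¬(v.1 = w.1 ∧ v.2 = w.2) from fun h' => h (Prod.ext h'.1 h'.2)), if_neg h]

/-- Row permutations are in the notch (as elements of `GL`). [folklore] -/
theorem exists_mem_rowPerm (σ : Equiv.Perm (Fin m)) :
    ∃ γ ∈ signedRowSubst m, (γ : Matrix (Fin m × Fin m) (Fin m × Fin m) ℂ) = signedRowMatrix m σ 1 :=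
  exists_mem_signedRowMatrix σ 1

/-- Row flips are in the notch. [folklore] -/
theorem exists_mem_rowFlip (i : Fin m) :
    ∃ γ ∈ signedRowSubst m, (γ : Matrix (Fin m × Fin m) (Fin m × Fin m) ℂ) =
      rowFlip m i := by
  obtain ⟨γ, hγ, h⟩ := exists_mem_signedRowMatrix (m := m) 1 (Function.update 1 i (-1))
  exact ⟨γ, hγ, h.trans (signedRowMatrix_flip i)⟩

/-- A signed row permutation is the Kronecker product `(P_{σ⁻¹} · diag ε) ⊗ 1` of a MONOMIAL `m × m` matrix
with the identity (LR's `N(T^{GL(E)})` acting on `Hom(F, E)`). [cite: LandsbergRessayre2017, §2.1] -/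
theorem signedRowMatrix_eq_kronecker (σ : Equiv.Perm (Fin m)) (ε : Fin m → ℤˣ) :
    signedRowMatrix m σ ε =
      ((σ⁻¹).permMatrix ℂ * Matrix.diagonal fun i => (((ε i : ℤˣ) : ℤ) : ℂ)) ⊗ₖ
        (1 : Matrix (Fin m) (Fin m) ℂ) := by
  have hP : ∀ a b : Fin m, Equiv.Perm.permMatrix ℂ σ⁻¹ a b = if a = σ b then (1 : ℂ) else 0 := fun a b => by
    simp only [PEquiv.toMatrix_apply, Equiv.toPEquiv_apply, Option.mem_def, Option.some.injEq,
      Equiv.Perm.inv_eq_iff_eq]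
  ext v w
  unfold signedRowMatrix
  rw [Matrix.of_apply, Matrix.kroneckerMap_apply, Matrix.mul_diagonal, Matrix.one_apply, hP]
  by_cases h1 : v.1 = σ w.1
  · by_cases h2 : v.2 = w.2
    · rw [if_pos (And.intro h1 h2), if_pos h1, if_pos h2, one_mul, mul_one]
    · rw [if_neg (show ¬(v.1 = σ w.1 ∧ v.2 = w.2) from fun h => h2 h.2), if_neg h2, mul_zero]
  · rw [if_neg (show ¬(v.1 = σ w.1 ∧ v.2 = w.2) from fun h => h1 h.1), if_neg h1, zero_mul, zero_mul]

/-- PLACEMENT 1: ROW `𝔖_m × 1 ≤ B_m`-rows — the row-permutation substitutions of the window lie in the notch.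
[cite: LandsbergRessayre2017, §2.1] -/
theorem mem_of_eq_permMatrix_prodCongr_refl {γ : GL (Fin m × Fin m) ℂ} {σ : Equiv.Perm (Fin m)}
    (h : (γ : Matrix (Fin m × Fin m) (Fin m × Fin m) ℂ) =
      Equiv.Perm.permMatrix ℂ (Equiv.prodCongr σ (Equiv.refl (Fin m)))) :
    γ ∈ signedRowSubst m := by
  refine mem_signedRowSubst_iff.2 ⟨σ⁻¹, 1, ?_⟩
  have hd : (Matrix.diagonal fun i : Fin m => (((1 : Fin m → ℤˣ) i : ℤ) : ℂ)) = 1 := by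
    simp only [Pi.one_apply, Units.val_one, Int.cast_one, Matrix.diagonal_one]
  rw [h, signedRowMatrix_eq_kronecker, inv_inv, hd, Matrix.mul_one, EquivariantDialNode.permMatrix_prodCongr,
    Matrix.permMatrix_refl]

/-- PLACEMENT 2: `B_m`-rows `≤ N(T^E) × 1` (Landsberg–Ressayre's left monomial symmetries): a FINITE sub-notch
of the LR notch, missing the torus. [cite: LandsbergRessayre2017, §2.1] -/
theorem signedRowSubst_le_leftMonomialSubst (m : ℕ) : signedRowSubst m ≤ leftMonomialSubst ℂ m := by
  intro γ hγ
  obtain ⟨σ, ε, h⟩ := mem_signedRowSubst_iff.1 hγ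
  have hε : ∀ i, (((ε i : ℤˣ) : ℤ) : ℂ) ≠ 0 := fun i => Int.cast_ne_zero.2 (Units.ne_zero (ε i))
  have hγeq : γ = Matrix.GeneralLinearGroup.kronecker
      (LRPencil.permUnit ℂ σ⁻¹ * LRPencil.diagUnit ℂ (fun i => (((ε i : ℤˣ) : ℤ) : ℂ)) hε) (1 : GL (Fin m) ℂ) :=
    Units.ext (by
      rw [h, signedRowMatrix_eq_kronecker, LRPencil.coe_kronecker_one, Units.val_mul, LRPencil.coe_permUnit,
        LRPencil.coe_diagUnit])
  rw [hγeq]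
  exact LRPencil.kronecker_one_mem ℂ
    (Subgroup.mul_mem _ (LRPencil.permUnit_mem ℂ σ⁻¹) (LRPencil.diagUnit_mem ℂ _ hε))

/-! ## Parity at the notch -/

/-- ★ PARITY AT THE NOTCH: a `B_m`-row-stable degree-`d` cut of `per_m` has width `≥ C(m, d)`.
[cite: LandsbergRessayre2017, Thm 2.8] -/
theorem choose_le_of_hasIdealWidthLE {d r : ℕ}
    (h : HasIdealWidthLE (signedRowSubst m) (perPoly (Fin m) ℂ) d r) : m.choose d ≤ r := by
  obtain ⟨s, hs, hhom, hstab, hper⟩ := h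
  refine le_trans (choose_le_card_of_stable hhom (fun i p hp => ?_) (fun σ p hp => ?_) hper) hs
  · obtain ⟨γ, hγ, hγe⟩ := exists_mem_rowFlip (m := m) i
    have h1 := hstab γ hγ p hp
    rwa [hγe] at h1
  · obtain ⟨γ, hγ, hγe⟩ := exists_mem_rowPerm σ
    have h1 := hstab γ hγ p hp
    rwa [hγe, linSubst_signedRowMatrix_one] at h1

/-- The same for the attained width (when the width set is non-empty). [cite: LandsbergRessayre2017, Thm 2.8] -/
theorem choose_le_idealWidth {d : ℕ} (hne : ∃ r, HasIdealWidthLE (signedRowSubst m) (perPoly (Fin m) ℂ) d r) :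
    m.choose d ≤ idealWidth (signedRowSubst m) (perPoly (Fin m) ℂ) d := by
  have h : HasIdealWidthLE (signedRowSubst m) (perPoly (Fin m) ℂ) d
      (idealWidth (signedRowSubst m) (perPoly (Fin m) ℂ) d) := Nat.sInf_mem hne
  exact choose_le_of_hasIdealWidthLE h

/-- Layered programs: a `B_m`-row-equivariant homogeneous layered program for `per_m` has width `≥ C(m, d)`
at every `d ≤ m` (equivariant Nisan cut + parity). [cite: LandsbergRessayre2017, Thm 2.8] -/
theorem choose_le_of_hasLayeredWidthLE {d w : ℕ} (hd : d ≤ m)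
    (h : HasLayeredWidthLE (signedRowSubst m) (perPoly (Fin m) ℂ) m w) : m.choose d ≤ w :=
  choose_le_of_hasIdealWidthLE (h.hasIdealWidthLE hd)

/-- ARITHMETIC: the central binomial coefficient beats the square of every polynomial. [folklore] -/
theorem exists_sq_lt_centralBinom (c : ℕ) :
    ∃ n : ℕ, 3 ≤ 2 * n ∧ ((2 * n) ^ c + c) * ((2 * n) ^ c + c) < (2 * n).choose n := by
  obtain ⟨T, hT⟩ := eventually_mul_pow_lt_two_pow (2 * c + 1) ((1 + c) ^ 2)
  obtain ⟨n, hnT, hn2⟩ : ∃ n, T ≤ n ∧ 2 ≤ n := ⟨max T 2, le_max_left _ _, le_max_right _ _⟩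
  refine ⟨n, by omega, ?_⟩
  have hN0 : 2 * n ≠ 0 := by omega
  have hc1 : c ≤ c * (2 * n) ^ c := Nat.le_mul_of_pos_right c (Nat.pos_of_ne_zero (pow_ne_zero c hN0))
  have h2 : (2 * n) ^ c + c ≤ (1 + c) * (2 * n) ^ c := by
    calc (2 * n) ^ c + c ≤ (2 * n) ^ c + c * (2 * n) ^ c := Nat.add_le_add_left hc1 _
      _ = (1 + c) * (2 * n) ^ c := by ring
  have h3 : 2 * n * (((2 * n) ^ c + c) * ((2 * n) ^ c + c)) ≤ (1 + c) ^ 2 * (2 * n) ^ (2 * c + 1) := by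
    calc 2 * n * (((2 * n) ^ c + c) * ((2 * n) ^ c + c))
        ≤ 2 * n * (((1 + c) * (2 * n) ^ c) * ((1 + c) * (2 * n) ^ c)) :=
          Nat.mul_le_mul_left _ (Nat.mul_le_mul h2 h2)
      _ = (1 + c) ^ 2 * (2 * n) ^ (2 * c + 1) := by ring
  have h4 : (1 + c) ^ 2 * (2 * n) ^ (2 * c + 1) < 2 ^ (2 * n) := hT (2 * n) (by omega)
  have h6 : 2 ^ (2 * n) ≤ 2 * n * (2 * n).choose n := by
    have h := Nat.four_pow_le_two_mul_self_mul_centralBinom n (by omega)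
    rw [Nat.centralBinom_eq_two_mul_choose] at h
    calc (2 : ℕ) ^ (2 * n) = 4 ^ n := by rw [pow_mul]; norm_num
      _ ≤ 2 * n * (2 * n).choose n := h
  exact Nat.lt_of_mul_lt_mul_left ((h3.trans_lt h4).trans_le h6)

/-- ★ THE LAYERED CELL AT THE SIGNED-ROW NOTCH: no polynomial-width family of `B_m`-row-equivariant homogeneous
layered branching programs for the permanents. [cite: LandsbergRessayre2017, Thm 2.8] -/
theorem eqHardLayered_signedRow : EqHardLayered signedRowSubst := by
  rintro ⟨c, hc⟩
  obtain ⟨n, h3, hlt⟩ := exists_sq_lt_centralBinom c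
  obtain ⟨w, hw, hP⟩ := hc (2 * n)
  have h := choose_le_of_hasLayeredWidthLE (show n ≤ 2 * n by omega) hP
  exact Nat.not_lt.2 ((h.trans hw).trans (Nat.le_mul_self _)) hlt

/-! ## The notch decided -/

/-- ★ RESTRICTED-MODEL LOWER BOUND: a `B_m`-row-equivariant (exact `GL × GL` lifts) affine determinantal
representation of `per_m`, `m ≥ 3`, of size `s` has `s² ≥ C(m, d)` for every `d ≤ m` — in particular
`s ≥ C(m, ⌊m/2⌋)^{1/2} ≥ 2^{m/2} / (m+1)`. [cite: LandsbergRessayre2017, Thm 2.8] -/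
theorem choose_le_sq_of_isEquivariantDetRepr (hm : 3 ≤ m) {s : ℕ}
    {A : Matrix (Fin s) (Fin s) (MvPolynomial (Fin m × Fin m) ℂ)}
    (hA : IsEquivariantDetRepr (signedRowSubst m) (perPoly (Fin m) ℂ) A) {d : ℕ} (hd : d ≤ m) :
    m.choose d ≤ s * s := by
  obtain ⟨e, rfl⟩ : ∃ e, m = e + 2 := ⟨m - 2, by omega⟩
  haveI := finite_signedRowSubst (e + 2)
  obtain ⟨s', hs', A', hA'⟩ := exists_finLift_of_isEquivariantDetRepr hA
  obtain ⟨N, hN, hB⟩ := hasBlockGaugeRepr_of_finLifts hm hA'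
  have hhom : (perPoly (Fin (e + 2)) ℂ).IsHomogeneous (e + 2) := by
    simpa only [Fintype.card_fin] using perPoly_isHomogeneous (n := Fin (e + 2)) (k := ℂ)
  have hI := (hasLayeredWidthLE_of_hasBlockGaugeRepr hhom hB).hasIdealWidthLE hd
  calc (e + 2).choose d ≤ N * N + (N + 1) := choose_le_of_hasIdealWidthLE hI
    _ ≤ N * N + (N + 1) + N := Nat.le_add_right _ _
    _ = s' * s' := by rw [← hN]; ring
    _ ≤ s * s := Nat.mul_le_mul hs' hs'

/-- ★ THE SIGNED-ROW NOTCH DECIDED: `EqHard B`-rows (no polynomial-size `B_m`-row-equivariant family).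
[cite: LandsbergRessayre2017, Thm 2.8] -/
theorem eqHard_signedRow : EqHard signedRowSubst := by
  rintro ⟨c, hc⟩
  obtain ⟨n, h3, hlt⟩ := exists_sq_lt_centralBinom c
  obtain ⟨s, hs, A, hA⟩ := hc (2 * n)
  have h := choose_le_sq_of_isEquivariantDetRepr h3 hA (show n ≤ 2 * n by omega)
  exact Nat.not_lt.2 (h.trans (Nat.mul_le_mul hs hs)) hlt

/-- Every notch containing the signed rows is decided (monotonicity up the dial). [cite: LandsbergRessayre2017, Thm 2.8] -/
theorem eqHard_of_signedRow_le {H : ∀ m : ℕ, Subgroup (GL (Fin m × Fin m) ℂ)}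
    (hle : ∀ m, signedRowSubst m ≤ H m) : EqHard H :=
  eqHard_signedRow.mono hle

/-- TERMINAL STATE (LESSON 6): the residual piece of the signed-row notch toward `W` is `W` itself.
[cite: LandsbergRessayre2017, Thm 2.8] -/
theorem symCheap_signedRow_iff : SymCheap signedRowSubst ↔ DcPerSuperpolynomial ℂ :=
  symCheap_iff_W_of_eqHard eqHard_signedRow

end Summit.ValiantsHypothesis.ValiantsHypothesis.Theorems.EquivariantDialSignedRows

end
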